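import Literature.NumberTheory.EllipticCurves.LatticeInclusionIsogenyDegreeProofs
import Literature.NumberTheory.EllipticCurves.ShimuraSubgroupHeckeCongruence
import Summits.BirchSwinnertonDyer.BirchSwinnertonDyer.Theorems.EisensteinDepletionAtTwoStarOptBNSFOddTransportRamified
import HarnessLib

/-!
# Line `nsf` on crux `StarOptBNSF` (item stmt-BirchSwinnertonDyer-27047): at a level with a traceless odd prime
# the SHIMURA COVER `E₁ → E₀` has ODD degree, so «Stevens' conjecture at 2 for the `X₁(N)`-optimal curve»
# transports to «the `X₀(N)`-optimal curve has no formal rational 2-torsion point»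

Lead bsd-rank2-star-p1 GEN 8; the kernel glue of planner p2 GEN 33's typed re-cut of the research stub
`stub_thmAShadow` (HOME/p2/g33/STEVENS-AT-TWO.md §5: T1 = Stevens at `ℓ = 2` for `E₁`, T2 = existence of `E₁`
with Néron lattice `c₁Λ₁(f)`, T3 = kernel).  T3 needs NO lattice-pairing lemma and NO any-degree «safe
direction»: in the NSF habitat the newform `f` has a traceless prime `p ∣ N` (`a_p(f) = 0`, `p` odd), the tree's
Ling–Oesterlé theorem `pMulLatticeLeGamma1OfTracelessPrime_holds` gives `pΛ_f ⊆ Λ₁(f)`, so the `ℚ`-isogeny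
`E₀ → E₁` attached to the rational lattice inclusion `(pc₁/q)·Λ_{E₀} = pc₁Λ_f ⊆ c₁Λ₁(f) = Λ_{E₁}` has degree
`[Λ₁(f) : pΛ_f] ∣ p²` — ODD — and GEN 7/8's odd-isogeny transport of formal rational 2-torsion applies.

* `odd_relIndex_of_forall_nsmul_mem` — a finite-index pair `A, B` of additive subgroups with `p·B ⊆ A`, `p` an
  odd prime, has odd relative index (Cauchy).
* `exists_isogeny_odd_degree_of_periodLattices` — `W₀` (Néron lattice `qΛ_f`), `W₁` (Néron lattice `c₁Λ₁(f)`),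
  `f` a newform with a traceless odd prime `p ∣ N`: there is a `ℚ`-isogeny `W₀ → W₁` of odd degree
  (`exists_isogeny_degree_eq_of_isNeronLatticeOf` with multiplier `pc₁/q`).
* `not_exists_ramified_of_gamma1Optimal` — THE TRANSPORT: if moreover both are globally minimal, `W₀` is good
  ordinary at `2`, and `W₁` has no formal rational 2-torsion point (= Stevens' conjecture at `2` for the class,
  STEVENS-AT-TWO.md Prop. 1), then `W₀` has no formal rational 2-torsion point — the only use line `nsf` makes of
  `stub_thmAShadow`.

HONEST FRAMING: bookkeeping theorems for a re-cut of the research stub of an OPEN crux; `StarOptBNSF` (27047) /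
`E1M_NSF` (27021) / BSD are NOT proved by them; nothing here reads an analytic rank.

References: S. Ling, J. Oesterlé, *The Shimura subgroup of `J₀(N)`*, Astérisque 196–197 (1991), Thm. 6
[LingOesterle1991]; G. Stevens, *Stickelberger elements and modular parametrizations of elliptic curves*, Invent.
Math. 98 (1989), §2 [Stevens1989]; V. Vatsal, *Multiplicative subgroups of `J₀(N)` and applications to elliptic
curves*, JIMJ 4 (2005), Rem. 1.8 [Vatsal2005]; J. H. Silverman, *AEC*, GTM 106 (2009), Thm. VI.4.1(b)
[SilvermanAEC2009].
-/

set_option linter.dupNamespace false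
set_option autoImplicit false

noncomputable section

open scoped Classical
open Literature.NumberTheory.EllipticCurves Literature.NumberTheory.EllipticCurves.Greenberg1999
open Literature.NumberTheory.EllipticCurves.ModularForms
open Summit.BirchSwinnertonDyer.BirchSwinnertonDyer.Theorems.DepletionAtTwo.OddTransportRamified

namespace Summit.BirchSwinnertonDyer.BirchSwinnertonDyer.Theorems.DepletionAtTwo.ShimuraCover

/-! ### A finite quotient killed by an odd prime has odd order -/

/-- **Cauchy.** If `A, B` are additive subgroups of a commutative group with `p • b ∈ A` for all `b ∈ B`, `p` an
odd prime, and `[B : A ∩ B]` finite (non-zero), then `[B : A ∩ B]` is odd: an element of order `2` of the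
quotient would have order dividing `p`. [folklore] -/
theorem odd_relIndex_of_forall_nsmul_mem {G : Type*} [AddCommGroup G] (A B : AddSubgroup G) {p : ℕ}
    (hp : p.Prime) (hp2 : p ≠ 2) (hpB : ∀ b ∈ B, p • b ∈ A) (hfin : A.relIndex B ≠ 0) :
    Odd (A.relIndex B) := by
  rw [AddSubgroup.relIndex] at hfin ⊢
  set H : AddSubgroup B := A.addSubgroupOf B with hH
  haveI : Finite (B ⧸ H) := Nat.finite_of_card_ne_zero (by rwa [← AddSubgroup.index] )
  rw [← Nat.not_even_iff_odd]
  intro heven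
  have h2 : 2 ∣ Nat.card (B ⧸ H) := by
    rw [← AddSubgroup.index]; exact even_iff_two_dvd.mp heven
  haveI : Fact (Nat.Prime 2) := ⟨Nat.prime_two⟩
  obtain ⟨x, hx⟩ := exists_prime_addOrderOf_dvd_card' (G := B ⧸ H) 2 h2
  -- every element of the quotient is killed by `p`
  have hkill : p • x = 0 := by
    obtain ⟨b, rfl⟩ := QuotientAddGroup.mk_surjective x
    rw [← QuotientAddGroup.mk_nsmul, QuotientAddGroup.eq_zero_iff, hH, AddSubgroup.mem_addSubgroupOf,
      AddSubgroup.coe_nsmul]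
    exact hpB b b.2
  have hdvd : addOrderOf x ∣ p := addOrderOf_dvd_of_nsmul_eq_zero hkill
  rw [hx] at hdvd
  exact hp2 ((Nat.prime_dvd_prime_iff_eq Nat.prime_two hp).mp hdvd).symm

/-! ### The odd Shimura cover -/

/-- **At a traceless odd prime the Shimura cover has odd degree.**  Let `f ∈ S₂(Γ₀(N))` be a newform with a
prime `p ∣ N`, `p ≠ 2`, `a_p(f) = 0`; `W₀/ℚ` elliptic with a Néron period pair `L₀` spanning `qΛ_f` (`q ∈ ℚˣ`;
the `X₀(N)`-optimal lattice clause) and `W₁/ℚ` elliptic with a Néron period pair `L₁` spanning `c₁Λ₁(f)`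
(`c₁ ∈ ℚˣ`; Stevens' `X₁(N)`-optimal lattice clause, `Gamma1ParametrizationData.IsOptimal`).  Then there is a
`ℚ`-isogeny `W₀ → W₁` of ODD degree: the isogeny of the rational lattice inclusion `(pc₁/q)Λ₀ = pc₁Λ_f ⊆ c₁Λ₁(f)`
(Ling–Oesterlé: `pΛ_f ⊆ Λ₁(f)`, tree `pMulLatticeLeGamma1OfTracelessPrime_holds`) has degree
`[(q/pc₁)Λ₁ : Λ₀] = [Λ₁(f) : pΛ_f]`, and this quotient is killed by `p`.
[cite: LingOesterle1991, Thm. 6 («T_p = p on Σ(N) for p ∣ N»)] [cite: SilvermanAEC2009, Thm. VI.4.1(b)] -/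
theorem exists_isogeny_odd_degree_of_periodLattices (W₀ W₁ : WeierstrassCurve ℚ) [W₀.IsElliptic]
    [W₁.IsElliptic] {N : ℕ} [NeZero N] (f : CuspForm (CongruenceSubgroup.Gamma0 N) 2) (hf : IsNewform0 f)
    {p : ℕ} (hp : p.Prime) (hp2 : p ≠ 2) (hpN : p ∣ N) (hap : cuspCoeff f p = 0)
    {L₀ L₁ : PeriodPair} (hL₀ : IsNeronLatticeOf (W₀.baseChange ℂ) L₀)
    (hL₁ : IsNeronLatticeOf (W₁.baseChange ℂ) L₁) {q c₁ : ℚ} (hq : q ≠ 0) (hc₁ : c₁ ≠ 0)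
    (hin₀ : ∀ w ∈ periodLattice f, (q : ℂ) * w ∈ L₀.lattice)
    (hout₀ : ∀ z ∈ L₀.lattice, ∃ w ∈ periodLattice f, z = (q : ℂ) * w)
    (hin₁ : ∀ w ∈ periodLatticeGamma1 f, (c₁ : ℂ) * w ∈ L₁.lattice)
    (hout₁ : ∀ z ∈ L₁.lattice, ∃ w ∈ periodLatticeGamma1 f, z = (c₁ : ℂ) * w) :
    ∃ φ : WeierstrassCurve.Isogeny W₀ W₁, Odd φ.degree := by
  -- Ling–Oesterlé: `p Λ_f ⊆ Λ₁(f)`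
  have hLO : ∀ w ∈ periodLattice f, (p : ℂ) * w ∈ periodLatticeGamma1 f :=
    pMulLatticeLeGamma1OfTracelessPrime_holds N f hf p hp hpN hap
  have hpQ : (p : ℚ) ≠ 0 := by exact_mod_cast hp.ne_zero
  set c : ℚ := p * c₁ / q with hc
  have hc0 : c ≠ 0 := div_ne_zero (mul_ne_zero hpQ hc₁) hq
  have hcC : (c : ℂ) = (p : ℂ) * (c₁ : ℂ) / (q : ℂ) := by rw [hc]; push_cast; ring
  have hqC : (q : ℂ) ≠ 0 := by exact_mod_cast hq
  -- the rational lattice inclusion `c Λ₀ ⊆ Λ₁`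
  have hle : ∀ z ∈ L₀.lattice, (c : ℂ) * z ∈ L₁.lattice := by
    intro z hz
    obtain ⟨w, hw, rfl⟩ := hout₀ z hz
    have h1 : (c : ℂ) * ((q : ℂ) * w) = (c₁ : ℂ) * ((p : ℂ) * w) := by
      rw [hcC]; field_simp
    rw [h1]
    exact hin₁ _ (hLO w hw)
  obtain ⟨φ, hdeg⟩ := exists_isogeny_degree_eq_of_isNeronLatticeOf W₀ W₁ hL₀ hL₁ hc0 hle
  refine ⟨φ, ?_⟩
  rw [hdeg]
  -- the quotient `c⁻¹Λ₁ / Λ₀` is killed by `p`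
  refine odd_relIndex_of_forall_nsmul_mem _ _ hp hp2 (fun b hb ↦ ?_) (by rw [← hdeg]; exact φ.degree_pos.ne')
  rw [AddSubgroup.mem_comap, AddMonoidHom.coe_mulLeft, Submodule.mem_toAddSubgroup] at hb
  obtain ⟨w, hw, hbw⟩ := hout₁ _ hb
  have hwf : w ∈ periodLattice f := periodLatticeGamma1_le_periodLattice f hw
  have hb' : (p : ℂ) * b = (q : ℂ) * w := by
    rw [hcC] at hbw
    have hpC : (p : ℂ) ≠ 0 := by exact_mod_cast hp.ne_zero
    have hc₁C : (c₁ : ℂ) ≠ 0 := by exact_mod_cast hc₁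
    field_simp at hbw
    linear_combination hbw
  rw [Submodule.mem_toAddSubgroup, nsmul_eq_mul, hb']
  exact hin₀ w hwf

/-! ### The transport of «no formal rational 2-torsion» from `E₁` to `E₀` -/

/-- **Stevens-at-2 for `E₁` ⇒ no formal rational 2-torsion on `E₀`, at a level with a traceless odd prime.**
For globally minimal elliptic `W₀, W₁/ℚ`, `W₀` good ordinary at `2`, a newform `f` with a traceless odd prime
`p ∣ N`, Néron lattices `L₀ = qΛ_f`, `L₁ = c₁Λ₁(f)` (`q, c₁ ∈ ℚˣ`): if `W₁` has no rational 2-torsion abscissa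
ramified at `2` (no FORMAL rational point of order `2`), then neither has `W₀`.  Proof: the odd-degree isogeny
`W₀ → W₁` of `exists_isogeny_odd_degree_of_periodLattices` transports formal rational 2-torsion
(`not_exists_ramified_of_isogeny_of_odd`, lead GEN 8 over GEN 7's inertia core). This is exactly what line
`nsf` extracts from its research stub. [cite: Stevens1989, §2] [cite: LingOesterle1991, Thm. 6]
[cite: GreenbergLNM1716, §5 p. 168] -/
theorem not_exists_ramified_of_gamma1Optimal (W₀ W₁ : WeierstrassCurve ℚ) [W₀.IsElliptic]
    [W₀.IsGloballyMinimal] [W₁.IsElliptic] [W₁.IsGloballyMinimal] (hord : IsOrdinaryAt W₀ 2)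
    {N : ℕ} [NeZero N] (f : CuspForm (CongruenceSubgroup.Gamma0 N) 2) (hf : IsNewform0 f)
    {p : ℕ} (hp : p.Prime) (hp2 : p ≠ 2) (hpN : p ∣ N) (hap : cuspCoeff f p = 0)
    {L₀ L₁ : PeriodPair} (hL₀ : IsNeronLatticeOf (W₀.baseChange ℂ) L₀)
    (hL₁ : IsNeronLatticeOf (W₁.baseChange ℂ) L₁) {q c₁ : ℚ} (hq : q ≠ 0) (hc₁ : c₁ ≠ 0)
    (hin₀ : ∀ w ∈ periodLattice f, (q : ℂ) * w ∈ L₀.lattice)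
    (hout₀ : ∀ z ∈ L₀.lattice, ∃ w ∈ periodLattice f, z = (q : ℂ) * w)
    (hin₁ : ∀ w ∈ periodLatticeGamma1 f, (c₁ : ℂ) * w ∈ L₁.lattice)
    (hout₁ : ∀ z ∈ L₁.lattice, ∃ w ∈ periodLatticeGamma1 f, z = (c₁ : ℂ) * w)
    (hno₁ : ¬ ∃ x₁ : ℚ, HasRationalTwoTorsionX W₁ x₁ ∧ TwoTorsionRamifiedAtTwo x₁) :
    ¬ ∃ x₀ : ℚ, HasRationalTwoTorsionX W₀ x₀ ∧ TwoTorsionRamifiedAtTwo x₀ := by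
  obtain ⟨φ, hodd⟩ := exists_isogeny_odd_degree_of_periodLattices W₀ W₁ f hf hp hp2 hpN hap hL₀ hL₁ hq hc₁
    hin₀ hout₀ hin₁ hout₁
  exact not_exists_ramified_of_isogeny_of_odd φ hodd hord hno₁

end Summit.BirchSwinnertonDyer.BirchSwinnertonDyer.Theorems.DepletionAtTwo.ShimuraCover

end
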